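import Summits.QuantumFields.YangMills.Theorems.BalabanUVNodesN15KingModelCurvedKnitField
import HarnessLib

/-!
# Route «BalabanUVNodes» (cluster K4 «SpineRates»), Track-A DAG node N15 = NE2 — PART Ω-f, CLOSED EDITION: the curved knit's King inhabitant with a NON-CONSTANT `𝔲(N)`-valued
# gauge field `A′` (file 4 `uN_hasMaj_idef_curvDressed_kingTorus_king_field`) with the Neumann smallness DISCHARGED and the fit letter ABSORBED — a hypothesis-free η-rate
# statement for King's propagator dressed by `Ad(e^{η′A′(x)})`, `A′` small and slowly varying

Cell `pub-ymgap`, WIDTH SEAT `pub-ymgap-dag-n15-w2` (director-ym №197 ∕ HUMAN RULING D-0149), generation 3, file 5.  `bears_on: R4∕N15 · K3⁷ SpineGivenEndpointR13SepCoPH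
(stmt-QuantumFields-20544)`.  Filed `--kind proof --supports stmt-QuantumFields-20544 --as helper` — COUNT-NEUTRAL; theorems only (0 `def`, 0 `sorry`).  Imports BY NAME this seat's
file 4 `…N15KingModelCurvedKnitField` (through it dag-n15-e's Ω-c `knitConst_le` and this seat's p599926 `basisConst_le_sqrt_card_of_traceForm`); nothing re-declared.

WHY.  File 4 displays, besides the potential's three letters, the knit's Neumann smallness `β·R_V(2a₀, 0, 2g_A)·c_d·c_r < 1` and carries p595387's raw majorant (inductive-datum
defect + fit letters).  As in this seat's file 1 for the constant datum: the row letter `R_V(t, 0, t)` is LINEAR-bounded in `t ∈ [0, 1]` (§1), the fit letter at `r = g = G₂ = t`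
carries one factor `η = L^{−K}` in every summand (§2), so ONE small-field bound `a₀` (depending on the rung's `β, δ`, on `d` and on the fibre dimension) makes the smallness hold
and puts the whole majorant in the form `C·θ_K·e^{−(δ∕2)d}`, `θ_K = (L^K)^{−γ∕2} + (L^K)^{−α}` (§3).

WHAT: §1 `expRowLetter_field_eq` ∕ `expRowLetter_field_le`; §2 `expFitLetter_field_eq` ∕ `expFitLetter_field_le`; §3 `knitFieldConst_le` (pure arithmetic after Ω-c's `knitConst_le`),
★★ `uN_hasMaj_idef_curvDressed_kingTorus_king_field_closed` (`∃ δ C a₀ > 0, ∀ K ≥ 1, cube 2L^e, 0 < m² ≤ m₀², Msz, ∀ A′` skew-Hermitian with `‖A′‖ ≤ a₀`, `‖A′(y′) − A′(y′ − e_ν)‖ ≤ η′a₀`,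
`‖∇_ν∇_μA′‖ ≤ η′a₀`: majorant `C·θ_K·e^{−(δ∕2)|y−y′|_T}`; displayed NOTHING but the three small-field bounds, the skew-Hermitian values and `he`).

HONEST FRAMING ∕ LIMITS.  Arithmetic over file 4; King's `A = 0` propagator at the FLAT base point dressed by a LINEARISED transporter (coarse generator = block mean) — a positive
control ∕ non-vacuity certificate of the curved knit for the programme's fibre, NOT an estimate of Bałaban's `G(U)`; nothing of [B6]∕[B9] asserted ((3.35)–(3.37) p. 396, (3.50)
p. 400, Thm 3.1 (3.42) p. 397, (3.63)–(3.65) pp. 402–403 cited as SHAPES ∕ MECHANISM).  NE2⁺ NOT PRINTED ∕ NOT proved for d = 4; N15 NOT discharged; K3⁷ OPEN; counts UNMOVED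
(typed 28∕28 · discharged 5∕27, A 5∕28); one finite 𝕋⁴ at fixed ε — NOT infinite volume, NOT OS on ℝ⁴, NOT a mass gap, NOT Clay; R4 closes the conditional finite-𝕋⁴ rung
`BalabanLadder.UV` only.  Restate-immune (no Theses import).
-/

set_option autoImplicit false

noncomputable section
open scoped BigOperators Matrix Matrix.Norms.Frobenius

namespace Summit.QuantumFields.YangMills.BalabanUVNodes.N15.CurvedSpecies

open Real Finset NormedSpace
open Literature.MathematicalPhysics.QuantumFieldTheory.Balaban1983to89
open Literature.MathematicalPhysics.QuantumFieldTheory.Balaban1983to89.B11SectG (BlockNorm HasMaj)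
open Literature.MathematicalPhysics.QuantumFieldTheory.Balaban1983to89.T4EtaRateDefect (idef)
open Literature.MathematicalPhysics.QuantumFieldTheory.Balaban1983to89.T4EtaRateCoeffDefect (pull)
open Literature.MathematicalPhysics.QuantumFieldTheory.Balaban1983to89.B5Prop11Plancherel (Tor fine unitVec)
open Literature.MathematicalPhysics.QuantumFieldTheory.King1986.Torus (blockOf tdistT)
open Literature.MathematicalPhysics.QuantumFieldTheory.Balaban1983to89.Beta.AveragingCorrectionJets (adCLM)
open Literature.Barriers.QuantumFields (traceForm)
open Summit.QuantumFields.YangMills.BalabanUVNodes.N15.VectorPiece (unitTorusGeoS)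
open Summit.QuantumFields.YangMills.BalabanUVNodes.N15.MatrixSpecies (liftMap liftBlk coordMat basisConst basisConst_nonneg)
open Summit.QuantumFields.YangMills.BalabanUVNodes.N15.BackgroundLayer (liftPair blkPair)
open Summit.QuantumFields.YangMills.BalabanUVNodes.N15KingModelRung.Curved (kingGT kingGT₁ knitConst_le)

section Closed

variable (ι J : Type) [Fintype ι] [Fintype J]

/-! ## §1 The row letter of a field -/

/-- THE ROW LETTER OF A FIELD WITH `r = g = t`, `r_B = 0`, EXPLICIT: `R_V(t, 0, t) = κet(|ι| + |ι|³) + |ι||J|(|ι|(κet)² + κet)`. [folklore] -/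
theorem expRowLetter_field_eq (κ t : ℝ) :
    expRowLetter ι J κ t 0 t = κ * Real.exp 1 * t * ((Fintype.card ι : ℝ) + (Fintype.card ι : ℝ) ^ 3) +
      (Fintype.card ι : ℝ) * ((Fintype.card J : ℝ) * ((Fintype.card ι : ℝ) * (κ * Real.exp 1 * t) ^ 2 + κ * Real.exp 1 * t)) := by
  unfold expRowLetter curvRowLetter
  ring

/-- … LINEAR-BOUNDED in `t ∈ [0, 1]`, monotone in the basis constant `κ ≤ s`: `R_V(t, 0, t) ≤ t·(se(|ι| + |ι|³) + |ι||J|(|ι|s²e² + se))`. [folklore] -/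
theorem expRowLetter_field_le {κ s t : ℝ} (hκ : 0 ≤ κ) (hκs : κ ≤ s) (ht0 : 0 ≤ t) (ht1 : t ≤ 1) :
    expRowLetter ι J κ t 0 t ≤ t * (s * Real.exp 1 * ((Fintype.card ι : ℝ) + (Fintype.card ι : ℝ) ^ 3) +
      (Fintype.card ι : ℝ) * ((Fintype.card J : ℝ) * ((Fintype.card ι : ℝ) * (s * Real.exp 1) ^ 2 + s * Real.exp 1))) := by
  rw [expRowLetter_field_eq]
  have he : 0 ≤ Real.exp 1 := Real.exp_nonneg 1
  have hs : 0 ≤ s := hκ.trans hκs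
  have hk : (0 : ℝ) ≤ Fintype.card ι := Nat.cast_nonneg _
  have hkJ : (0 : ℝ) ≤ Fintype.card J := Nat.cast_nonneg _
  have h1 : κ * Real.exp 1 * t ≤ s * Real.exp 1 * t := by gcongr
  have h2 : (κ * Real.exp 1 * t) ^ 2 ≤ t * (s * Real.exp 1) ^ 2 := by
    have h3 : κ * Real.exp 1 * t ≤ s * Real.exp 1 * 1 := by gcongr
    have h4 : 0 ≤ κ * Real.exp 1 * t := by positivity
    calc (κ * Real.exp 1 * t) ^ 2 = (κ * Real.exp 1 * t) * (κ * Real.exp 1 * t) := sq _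
      _ ≤ (s * Real.exp 1 * 1) * (s * Real.exp 1 * t) := mul_le_mul h3 (by gcongr) h4 (by positivity)
      _ = t * (s * Real.exp 1) ^ 2 := by ring
  have h5 : κ * Real.exp 1 * t ≤ t * (s * Real.exp 1) := by linarith
  calc κ * Real.exp 1 * t * ((Fintype.card ι : ℝ) + (Fintype.card ι : ℝ) ^ 3) +
        (Fintype.card ι : ℝ) * ((Fintype.card J : ℝ) * ((Fintype.card ι : ℝ) * (κ * Real.exp 1 * t) ^ 2 + κ * Real.exp 1 * t))
      ≤ t * (s * Real.exp 1) * ((Fintype.card ι : ℝ) + (Fintype.card ι : ℝ) ^ 3) +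
        (Fintype.card ι : ℝ) * ((Fintype.card J : ℝ) * ((Fintype.card ι : ℝ) * (t * (s * Real.exp 1) ^ 2) + t * (s * Real.exp 1))) := by gcongr
    _ = _ := by ring

/-! ## §2 The fit letter of a field -/

/-- THE FIT LETTER OF A FIELD WITH `r = g = G₂ = t`, `r_B = g_B = 0`, EXPLICIT (the knit's fit arguments `o = d′ηt`, `o_t = d′ηt + ηt`, `o_W = 0`, `o_D = (d′+1)ηt` at spacing `η`):
every summand carries exactly one factor `η`. [folklore] -/
theorem expFitLetter_field_eq (κ t η d' : ℝ) :
    expFitLetter ι J κ t 0 t (d' * η * t) (d' * η * t + η * t) (d' * η * 0 + η * 0) ((d' + 1) * η * t) η =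
      η * ((Fintype.card ι : ℝ) * (κ * (Real.exp 1 * d' * t + 2 * Real.exp 1 * t ^ 2)) +
        (Fintype.card ι : ℝ) ^ 3 * (κ * (Real.exp 1 * (d' * t + t) + 2 * Real.exp 1 * t ^ 2)) +
        (Fintype.card ι : ℝ) * ((Fintype.card J : ℝ) * (2 * (Fintype.card ι : ℝ) * (κ * (Real.exp 1 * d' * t + 2 * Real.exp 1 * t ^ 2)) * (κ * Real.exp 1 * t) +
          κ * ((d' + 1) * t + 2 * Real.exp 1 * t ^ 2)))) := by
  unfold expFitLetter curvFitLetter gradFitLetter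
  ring

/-- … BOUNDED BY `η` TIMES A CONSTANT for `t ∈ [0, 1]`, `κ ≤ s`: the fit part of the η-rate is an η-RATE letter uniformly in the small field. [folklore] -/
theorem expFitLetter_field_le {κ s t η d' : ℝ} (hκ : 0 ≤ κ) (hκs : κ ≤ s) (ht0 : 0 ≤ t) (ht1 : t ≤ 1) (hη : 0 ≤ η) (hd : 0 ≤ d') :
    expFitLetter ι J κ t 0 t (d' * η * t) (d' * η * t + η * t) (d' * η * 0 + η * 0) ((d' + 1) * η * t) η ≤
      η * ((Fintype.card ι : ℝ) * (s * (Real.exp 1 * d' + 2 * Real.exp 1)) +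
        (Fintype.card ι : ℝ) ^ 3 * (s * (Real.exp 1 * (d' + 1) + 2 * Real.exp 1)) +
        (Fintype.card ι : ℝ) * ((Fintype.card J : ℝ) * (2 * (Fintype.card ι : ℝ) * (s * (Real.exp 1 * d' + 2 * Real.exp 1)) * (s * Real.exp 1) +
          s * ((d' + 1) + 2 * Real.exp 1)))) := by
  rw [expFitLetter_field_eq]
  have he : 0 ≤ Real.exp 1 := Real.exp_nonneg 1
  have ht2 : t ^ 2 ≤ 1 := pow_le_one₀ ht0 ht1
  have hk : (0 : ℝ) ≤ Fintype.card ι := Nat.cast_nonneg _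
  have hkJ : (0 : ℝ) ≤ Fintype.card J := Nat.cast_nonneg _
  have hs : 0 ≤ s := hκ.trans hκs
  have h1 : Real.exp 1 * d' * t + 2 * Real.exp 1 * t ^ 2 ≤ Real.exp 1 * d' + 2 * Real.exp 1 := by nlinarith [mul_nonneg he hd]
  have h2 : Real.exp 1 * (d' * t + t) + 2 * Real.exp 1 * t ^ 2 ≤ Real.exp 1 * (d' + 1) + 2 * Real.exp 1 := by nlinarith [mul_nonneg he hd]
  have h3 : (d' + 1) * t + 2 * Real.exp 1 * t ^ 2 ≤ (d' + 1) + 2 * Real.exp 1 := by nlinarith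
  have h4 : κ * Real.exp 1 * t ≤ s * Real.exp 1 := by nlinarith [mul_nonneg hκ he, mul_nonneg hs he]
  have h10 : 0 ≤ Real.exp 1 * d' * t + 2 * Real.exp 1 * t ^ 2 := by positivity
  gcongr

/-! ## §3 The closed statement -/

/-- THE KNIT's η-RATE CONSTANT FOR A FIELD UNDER THE SMALL-FIELD CHOICE (pure arithmetic, after dag-n15-e's `knitConst_le`): smallness `βRc ≤ ½`, fit `F ≤ Φθ` ⟹
`2c(mθ(1 + 2βR) + 2β²F) ≤ (2cm + 2m + 4cβ²Φ + 1)θ`. [folklore] -/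
theorem knitFieldConst_le {c m θ β R F Φ : ℝ} (hc : 0 ≤ c) (hm : 0 ≤ m) (hθ : 0 ≤ θ) (hF : F ≤ Φ * θ) (hq : β * R * c ≤ 1 / 2) :
    2 * c * (m * θ * (1 + 2 * β * R) + 2 * β ^ 2 * F) ≤ (2 * c * m + 2 * m + 4 * c * β ^ 2 * Φ + 1) * θ := by
  have hT1 : 2 * c * (m * θ * (1 + 2 * β * R)) ≤ (2 * c * m + 2 * m) * θ := by
    have h := mul_le_mul_of_nonneg_left hq (show 0 ≤ 4 * m * θ by positivity)
    have e1 : 2 * c * (m * θ * (1 + 2 * β * R)) = 2 * c * m * θ + 4 * m * θ * (β * R * c) := by ring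
    have e2 : (2 * c * m + 2 * m) * θ = 2 * c * m * θ + 4 * m * θ * (1 / 2) := by ring
    rw [e1, e2]; linarith
  have hT2 : 2 * c * (2 * β ^ 2 * F) ≤ 4 * c * β ^ 2 * Φ * θ := by
    have := mul_le_mul_of_nonneg_left hF (show 0 ≤ 4 * c * β ^ 2 by positivity); linarith
  nlinarith

variable {d : ℕ} (L : ℕ) [NeZero L]
variable {n : Type} [Fintype n] [DecidableEq n] {κ : Type} [Fintype κ] [DecidableEq κ] (e : Matrix n n ℂ ≃L[ℝ] (κ → ℝ))

/-- ★★ **THE CLOSED η-RATE STATEMENT FOR A SMALL, SLOWLY VARYING NON-ABELIAN GAUGE FIELD.**  For odd `L ≥ 3`, `a > 0`, `m₀² ≥ 0`, `0 < γ < 1`, `0 < α < 1` and trace-form-orthonormal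
coordinates `e` of `M_N(ℂ)` there are `δ, C, a₀ > 0` such that for EVERY `K ≥ 1`, cube `2L^e`, mass `0 < m² ≤ m₀²`, size datum, and EVERY skew-Hermitian lattice gauge field `A′` on the
fine torus with `‖A′_μ(y′)‖ ≤ a₀`, `‖A′_μ(y′) − A′_μ(y′ − e_ν)‖ ≤ η′a₀`, `‖∇_ν∇_μ A′‖ ≤ η′a₀` (`η′ = L^{−(K+1)}`): the η-defect of the dressed pairs of King's full `A = 0` propagator —
dressed by `Ad(e^{η′A′(x)})` on the fine torus and by the block-mean transporter on the coarse one — has the block majorant `C·((L^K)^{−γ∕2} + (L^K)^{−α})·e^{−(δ∕2)|y−y′|_T}`.  §2 with the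
Neumann smallness DISCHARGED (`expRowLetter_field_le` + p599926's `κ_e ≤ √|κ|`) and the fit letter ABSORBED (`expFitLetter_field_le`: `≤ L^{−K}·Φ ≤ (L^K)^{−α}·Φ`).  Displayed: NOTHING but the
three small-field bounds, the skew-Hermitian values and `he`. [cite: Balaban1985BackgroundPropagators, (3.35)–(3.37) p.396, (3.50) p.400 (shapes), Thm 3.1 (3.42) p.397 (η-rate shape), (3.63)–(3.65) pp.402–403 (mechanism); King1986, Prop. 3.9 (3.73) p.665 (template)] -/
theorem uN_hasMaj_idef_curvDressed_kingTorus_king_field_closed (he : ∀ X Y : Matrix n n ℂ, traceForm X Y = e X ⬝ᵥ e Y) (hLodd : Odd L) (hL : 2 ≤ L) {a : ℝ} (ha : 0 < a)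
    {m0sq : ℝ} (hm0 : 0 ≤ m0sq) {γ : ℝ} (hγ0 : 0 < γ) (hγ1 : γ < 1) {α : ℝ} (hα0 : 0 < α) (hα1 : α < 1) :
    ∃ δ C a₀ : ℝ, 0 < δ ∧ 0 < C ∧ 0 < a₀ ∧ ∀ (K : ℕ), 1 ≤ K → ∀ (ex : ℕ) (M : Fin (d + 1) → ℕ) [∀ μ, NeZero (M μ)], (∀ μ, M μ = 2 * L ^ ex) →
      ∀ (msq : ℝ), 0 < msq → msq ≤ m0sq → ∀ (Msz : ℝ) (A' : Fin (d + 1) → Tor (fine L (fine (L ^ K) M)) → Matrix n n ℂ),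
      (∀ μ y', ‖A' μ y'‖ ≤ a₀) →
      (∀ μ ν y', ‖A' μ y' - A' μ (y' - unitVec (fine L (fine (L ^ K) M)) ν)‖ ≤ ((L : ℝ) ^ (K + 1))⁻¹ * a₀) →
      (∀ μ ν (z' : Tor (fine L (fine (L ^ K) M))), ‖(((L : ℝ) ^ (K + 1))⁻¹)⁻¹ • (A' μ (z' + unitVec (fine L (fine (L ^ K) M)) ν + unitVec (fine L (fine (L ^ K) M)) μ) -
          A' μ (z' + unitVec (fine L (fine (L ^ K) M)) ν)) - (((L : ℝ) ^ (K + 1))⁻¹)⁻¹ • (A' μ (z' + unitVec (fine L (fine (L ^ K) M)) μ) - A' μ z')‖ ≤ ((L : ℝ) ^ (K + 1))⁻¹ * a₀) →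
      (∀ μ y', (A' μ y')ᴴ = -A' μ y') →
    HasMaj (BlockNorm.ofBlocks (unitTorusGeoS L K M Msz) (liftBlk (blockOf (L ^ K) M) κ)) (BlockNorm.ofBlocks (unitTorusGeoS L K M Msz) (blkPair (liftBlk (blockOf (L ^ K) M ∘ blockOf L (fine (L ^ K) M)) κ)))
      (idef (pull (liftMap (blockOf L (fine (L ^ K) M)) κ)) (pull (liftPair (liftMap (blockOf L (fine (L ^ K) M)) κ)))
        (curvDressed ((L : ℝ) ^ (K + 1))⁻¹ (torStep (fine L (fine (L ^ K) M))) (expTrField e ((L : ℝ) ^ (K + 1))⁻¹ 0) (expTrField e ((L : ℝ) ^ (K + 1))⁻¹ (fun μ y' => adCLM ℝ (A' μ y'))) (kingGT₁ L a msq K M κ))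
        (curvDressed ((L : ℝ) * ((L : ℝ) ^ (K + 1))⁻¹) (torStep (fine (L ^ K) M)) (expTrField e ((L : ℝ) * ((L : ℝ) ^ (K + 1))⁻¹) (blockMeanField L (fine (L ^ K) M) 0)) (expTrField e ((L : ℝ) * ((L : ℝ) ^ (K + 1))⁻¹) (blockMeanField L (fine (L ^ K) M) (fun μ y' => adCLM ℝ (A' μ y')))) (kingGT L a msq K M κ)))
        (fun y y' => C * (((L : ℝ) ^ K) ^ (-(γ / 2)) + ((L : ℝ) ^ K) ^ (-α)) * Real.exp (-(δ / 2 * tdistT M y y'))) := by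
  obtain ⟨β, δ, m, hβ, hδ, hm, H⟩ := uN_hasMaj_idef_curvDressed_kingTorus_king_field (d := d) L e he hLodd hL ha hm0 hγ0 hγ1 hα0 hα1
  -- level-independent letters: `c_r`, `c_d = 1 + |J ⊕ J|`, `s = √|κ| ≥ κ_e`, `d′ = d + 1`, the row slope `S`, the fit constant `Φ`, `D = 4β(S c_d)c_r + 1`
  have hexp : 0 ≤ Real.exp 1 := Real.exp_nonneg 1
  have hc : 0 ≤ B4Sect5Proof.latticeConst (d + 1) (δ / 2) := B4Sect5Proof.latticeConst_nonneg (d + 1) (half_pos hδ).le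
  have hcd : (0 : ℝ) ≤ 1 + Fintype.card (Fin (d + 1) ⊕ Fin (d + 1)) := by positivity
  have hk : (0 : ℝ) ≤ Fintype.card κ := Nat.cast_nonneg _
  have hdJ : (0 : ℝ) ≤ Fintype.card (Fin (d + 1)) := Nat.cast_nonneg _
  have hd' : (0 : ℝ) ≤ ((d + 1 : ℕ) : ℝ) := Nat.cast_nonneg _
  have hs : 0 ≤ Real.sqrt (Fintype.card κ) := Real.sqrt_nonneg _
  have hκ0 : 0 ≤ basisConst e := basisConst_nonneg e
  have hκs : basisConst e ≤ Real.sqrt (Fintype.card κ) := basisConst_le_sqrt_card_of_traceForm e he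
  obtain ⟨S, hS_def⟩ : ∃ S : ℝ, S = Real.sqrt (Fintype.card κ) * Real.exp 1 * ((Fintype.card κ : ℝ) + (Fintype.card κ : ℝ) ^ 3) +
      (Fintype.card κ : ℝ) * ((Fintype.card (Fin (d + 1)) : ℝ) * ((Fintype.card κ : ℝ) * (Real.sqrt (Fintype.card κ) * Real.exp 1) ^ 2 + Real.sqrt (Fintype.card κ) * Real.exp 1)) := ⟨_, rfl⟩
  have hS : 0 ≤ S := by rw [hS_def]; positivity
  obtain ⟨P, hP_def⟩ : ∃ P : ℝ, P = (Fintype.card κ : ℝ) * (Real.sqrt (Fintype.card κ) * (Real.exp 1 * ((d + 1 : ℕ) : ℝ) + 2 * Real.exp 1)) +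
        (Fintype.card κ : ℝ) ^ 3 * (Real.sqrt (Fintype.card κ) * (Real.exp 1 * (((d + 1 : ℕ) : ℝ) + 1) + 2 * Real.exp 1)) +
        (Fintype.card κ : ℝ) * ((Fintype.card (Fin (d + 1)) : ℝ) * (2 * (Fintype.card κ : ℝ) * (Real.sqrt (Fintype.card κ) * (Real.exp 1 * ((d + 1 : ℕ) : ℝ) + 2 * Real.exp 1)) *
          (Real.sqrt (Fintype.card κ) * Real.exp 1) + Real.sqrt (Fintype.card κ) * ((((d + 1 : ℕ) : ℝ) + 1) + 2 * Real.exp 1))) := ⟨_, rfl⟩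
  have hP : 0 ≤ P := by rw [hP_def]; positivity
  have hΦ : 0 ≤ P * (1 + Fintype.card (Fin (d + 1) ⊕ Fin (d + 1))) := mul_nonneg hP hcd
  obtain ⟨D, hD_def⟩ : ∃ D : ℝ, D = 4 * β * (S * (1 + Fintype.card (Fin (d + 1) ⊕ Fin (d + 1)))) * B4Sect5Proof.latticeConst (d + 1) (δ / 2) + 1 := ⟨_, rfl⟩
  have hD : 0 < D := by rw [hD_def]; positivity
  refine ⟨δ, 2 * B4Sect5Proof.latticeConst (d + 1) (δ / 2) * m + 2 * m + 4 * B4Sect5Proof.latticeConst (d + 1) (δ / 2) * β ^ 2 * (P * (1 + Fintype.card (Fin (d + 1) ⊕ Fin (d + 1)))) + 1, min (1 / 2) (1 / (2 * D)), hδ,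
    by positivity, lt_min (by norm_num) (by positivity), fun K hK ex M _ hM msq hmsq hcap Msz A' hA hgradA hsecA hAs => ?_⟩
  -- the small-field bound `a₀ = min (1∕2) (1∕(2D))`: `t = 2a₀ ≤ 1`, `t ≤ 1∕D`
  have ha0 : 0 ≤ min (1 / 2 : ℝ) (1 / (2 * D)) := (lt_min (by norm_num : (0 : ℝ) < 1 / 2) (by positivity : (0 : ℝ) < 1 / (2 * D))).le
  have ht1 : 2 * min (1 / 2 : ℝ) (1 / (2 * D)) ≤ 1 := by have h := min_le_left (1 / 2 : ℝ) (1 / (2 * D)); linarith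
  have htD : 2 * min (1 / 2 : ℝ) (1 / (2 * D)) ≤ 1 / D := by
    have h := min_le_right (1 / 2 : ℝ) (1 / (2 * D))
    have e1 : 2 * (1 / (2 * D)) = 1 / D := by field_simp
    linarith
  have ht0 : 0 ≤ 2 * min (1 / 2 : ℝ) (1 / (2 * D)) := by positivity
  -- the Neumann smallness HOLDS (`βR_Vc_dc_r ≤ ½ < 1`)
  have hR : expRowLetter κ (Fin (d + 1)) (basisConst e) (2 * min (1 / 2 : ℝ) (1 / (2 * D))) 0 (2 * min (1 / 2 : ℝ) (1 / (2 * D))) * (1 + Fintype.card (Fin (d + 1) ⊕ Fin (d + 1))) ≤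
      2 * min (1 / 2 : ℝ) (1 / (2 * D)) * (S * (1 + Fintype.card (Fin (d + 1) ⊕ Fin (d + 1)))) := by
    rw [← mul_assoc]
    refine mul_le_mul_of_nonneg_right ?_ hcd
    rw [hS_def]
    exact expRowLetter_field_le κ (Fin (d + 1)) hκ0 hκs ht0 ht1
  have hq2 : β * (expRowLetter κ (Fin (d + 1)) (basisConst e) (2 * min (1 / 2 : ℝ) (1 / (2 * D))) 0 (2 * min (1 / 2 : ℝ) (1 / (2 * D))) *
      (1 + Fintype.card (Fin (d + 1) ⊕ Fin (d + 1)))) * B4Sect5Proof.latticeConst (d + 1) (δ / 2) ≤ 1 / 2 := by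
    have hT : 0 ≤ S * (1 + Fintype.card (Fin (d + 1) ⊕ Fin (d + 1))) := mul_nonneg hS hcd
    have h1 : β * (expRowLetter κ (Fin (d + 1)) (basisConst e) (2 * min (1 / 2 : ℝ) (1 / (2 * D))) 0 (2 * min (1 / 2 : ℝ) (1 / (2 * D))) *
        (1 + Fintype.card (Fin (d + 1) ⊕ Fin (d + 1)))) * B4Sect5Proof.latticeConst (d + 1) (δ / 2) ≤
        β * (1 / D * (S * (1 + Fintype.card (Fin (d + 1) ⊕ Fin (d + 1))))) * B4Sect5Proof.latticeConst (d + 1) (δ / 2) := by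
      exact mul_le_mul_of_nonneg_right (mul_le_mul_of_nonneg_left (hR.trans (mul_le_mul_of_nonneg_right htD hT)) hβ.le) hc
    have h2 : β * (1 / D * (S * (1 + Fintype.card (Fin (d + 1) ⊕ Fin (d + 1))))) * B4Sect5Proof.latticeConst (d + 1) (δ / 2) =
        (β * (S * (1 + Fintype.card (Fin (d + 1) ⊕ Fin (d + 1)))) * B4Sect5Proof.latticeConst (d + 1) (δ / 2)) / D := by ring
    have h3 : (β * (S * (1 + Fintype.card (Fin (d + 1) ⊕ Fin (d + 1)))) * B4Sect5Proof.latticeConst (d + 1) (δ / 2)) / D ≤ 1 / 2 := by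
      rw [div_le_iff₀ hD, hD_def]; nlinarith [mul_nonneg (mul_nonneg hβ.le hT) hc]
    linarith
  have key := H K hK ex M hM msq hmsq hcap Msz A' (min (1 / 2) (1 / (2 * D))) (min (1 / 2) (1 / (2 * D))) (min (1 / 2) (1 / (2 * D))) ha0 ht1 ha0 ha0
    hA hgradA hsecA hAs (by linarith)
  refine key.mono fun y y' => mul_le_mul_of_nonneg_right ?_ (Real.exp_nonneg _)
  -- letters of the level
  have hL1 : (1 : ℝ) ≤ (L : ℝ) := by exact_mod_cast (show 1 ≤ L by omega)
  have hL0 : (0 : ℝ) < (L : ℝ) := by positivity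
  have hθ : 0 ≤ ((L : ℝ) ^ K) ^ (-(γ / 2)) + ((L : ℝ) ^ K) ^ (-α) :=
    add_nonneg (Real.rpow_nonneg (pow_nonneg hL0.le _) _) (Real.rpow_nonneg (pow_nonneg hL0.le _) _)
  have hmθ : 0 ≤ m * (((L : ℝ) ^ K) ^ (-(γ / 2)) + ((L : ℝ) ^ K) ^ (-α)) := mul_nonneg hm.le hθ
  have hη0 : 0 ≤ (L : ℝ) * ((L : ℝ) ^ (K + 1))⁻¹ := by positivity
  have hηθ : (L : ℝ) * ((L : ℝ) ^ (K + 1))⁻¹ ≤ ((L : ℝ) ^ K) ^ (-(γ / 2)) + ((L : ℝ) ^ K) ^ (-α) := by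
    have h1 : (L : ℝ) * ((L : ℝ) ^ (K + 1))⁻¹ = ((L : ℝ) ^ K)⁻¹ := by
      rw [pow_succ, mul_inv, ← mul_assoc, mul_comm (L : ℝ), mul_assoc, mul_inv_cancel₀ hL0.ne', mul_one]
    rw [h1, ← Real.rpow_neg_one]
    exact (Real.rpow_le_rpow_of_exponent_le (one_le_pow₀ hL1) (by linarith)).trans (le_add_of_nonneg_left (Real.rpow_nonneg (pow_nonneg hL0.le _) _))
  -- the row letter and the fit letter at the small field
  have hR0 : 0 ≤ expRowLetter κ (Fin (d + 1)) (basisConst e) (2 * min (1 / 2 : ℝ) (1 / (2 * D))) 0 (2 * min (1 / 2 : ℝ) (1 / (2 * D))) *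
      (1 + Fintype.card (Fin (d + 1) ⊕ Fin (d + 1))) := mul_nonneg (expRowLetter_nonneg (ι := κ) (J := Fin (d + 1)) hκ0 ht0 le_rfl ht0) hcd
  have h1 := expFitLetter_field_le κ (Fin (d + 1)) (η := (L : ℝ) * ((L : ℝ) ^ (K + 1))⁻¹) (d' := ((d + 1 : ℕ) : ℝ)) hκ0 hκs ht0 ht1 hη0 hd'
  rw [← hP_def] at h1
  have hF := calc _ ≤ (L : ℝ) * ((L : ℝ) ^ (K + 1))⁻¹ * P * (1 + Fintype.card (Fin (d + 1) ⊕ Fin (d + 1))) := mul_le_mul_of_nonneg_right h1 hcd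
    _ = P * (1 + Fintype.card (Fin (d + 1) ⊕ Fin (d + 1))) * ((L : ℝ) * ((L : ℝ) ^ (K + 1))⁻¹) := by ring
    _ ≤ P * (1 + Fintype.card (Fin (d + 1) ⊕ Fin (d + 1))) * (((L : ℝ) ^ K) ^ (-(γ / 2)) + ((L : ℝ) ^ K) ^ (-α)) := mul_le_mul_of_nonneg_left hηθ hΦ
  have hF0 : 0 ≤ expFitLetter κ (Fin (d + 1)) (basisConst e) (2 * min (1 / 2 : ℝ) (1 / (2 * D))) 0 (2 * min (1 / 2 : ℝ) (1 / (2 * D)))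
      (((d + 1 : ℕ) : ℝ) * ((L : ℝ) * ((L : ℝ) ^ (K + 1))⁻¹) * (2 * min (1 / 2 : ℝ) (1 / (2 * D))))
      (((d + 1 : ℕ) : ℝ) * ((L : ℝ) * ((L : ℝ) ^ (K + 1))⁻¹) * (2 * min (1 / 2 : ℝ) (1 / (2 * D))) + (L : ℝ) * ((L : ℝ) ^ (K + 1))⁻¹ * (2 * min (1 / 2 : ℝ) (1 / (2 * D))))
      (((d + 1 : ℕ) : ℝ) * ((L : ℝ) * ((L : ℝ) ^ (K + 1))⁻¹) * 0 + (L : ℝ) * ((L : ℝ) ^ (K + 1))⁻¹ * 0)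
      ((((d + 1 : ℕ) : ℝ) + 1) * ((L : ℝ) * ((L : ℝ) ^ (K + 1))⁻¹) * (2 * min (1 / 2 : ℝ) (1 / (2 * D)))) ((L : ℝ) * ((L : ℝ) ^ (K + 1))⁻¹) *
      (1 + Fintype.card (Fin (d + 1) ⊕ Fin (d + 1))) := by
    refine mul_nonneg ?_ hcd
    rw [expFitLetter_field_eq]
    positivity
  exact (knitConst_le hmθ hc hR0 hβ.le hF0 hq2).trans (knitFieldConst_le hc hm.le hθ hF hq2)

end Closed

end Summit.QuantumFields.YangMills.BalabanUVNodes.N15.CurvedSpecies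

end
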